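import Mathlib.GroupTheory.QuotientGroup.Basic
import Mathlib.GroupTheory.Torsion
import Mathlib.Data.Set.Finite.Lattice
import HarnessLib

/-!
# The `p`-divisible core of a subgroup with finite `p`-torsion, and surjectivity of an
# endomorphism from surjectivity on a core (team n1011, seat p10 GEN 14 — TOOL, abstract algebra)

HONEST FRAMING (cell `b2b-bsdres-*`, team n1011, verbatim): prove what is provable now; shrink each
hard class to its core with data; no claim beyond stated classes. Research route; TOOL theorems
only (abstract additive groups) — no definition, no named fact, nothing booked, no residual-map
mark moved, no class closed.
Not a discharge of the registered fact A46 (`Fisher2016.thm44_selmerLocalKer_iff_of_nonsplit_good`;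
its `v ∣ p` disjunct stays), not a re-key of any record (consumers' lineages), closes no row, no §K.2 letter
(cell row T-ROOT, lead R5-132).

## What (the algebra behind `H¹_ur(K_v, E[p^∞]) = 0` at a place where the inertia invariants are
## NOT `p`-divisible, e.g. a non-split multiplicative place with `p ∣ ord_v Δ`)

Row T-GP6 (seat p10 GEN 11) proved `H¹_ur(K_v, E[p^∞]) = 0`, i.e. `Frob_v − 1` ONTO
`N = E[p^∞]^{I_v}`, when `N` is `p`-divisible.  In general `N ≅ (ℚ_p/ℤ_p)^a ⊕ (finite)` and the
right object is its maximal divisible subgroup.  Elementary substitutes, for an additive group `G`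
and a subgroup `N ≤ G`:

* `exists_forall_mem_of_forall_succ_subset` — a decreasing sequence of non-empty subsets of a
  finite set has a common element;
* `finite_setOf_nsmul_eq` — if `G[n]` is finite, so is every fibre `{y | n • y = x}`;
* `exists_nsmul_eq_of_forall_exists_pow_nsmul_eq` — **the elements of `N` having `p^k`-th roots in
  `N` for every `k` form a `p`-DIVISIBLE set** when `G[p]` is finite: such an `x` has a `p`-th root
  `y ∈ N` which again has `p^k`-th roots in `N` for every `k` (the sets
  `Y_k = {y ∈ N | p • y = x, y ∈ p^k N}` are non-empty, decreasing, inside the finite fibre of `x`);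
* `surjective_of_forall_exists_of_ker_subset` — **an endomorphism `f` of a `p`-primary group `G`
  with finite layers `G[p^k]` is SURJECTIVE as soon as it maps a subgroup `C` onto itself and
  `ker f ⊆ C`**: then `f x ∈ C ⇒ x ∈ C`, so `f` induces an injective endomorphism of `G ⧸ C`
  preserving the finite images of the layers `G[p^k]`, hence bijective on each of them.

References: [MilneADT2006] I §2 (`H¹(ĝ, N) = N/(φ − 1)N`); [GreenbergLNM1716] §3 Lemma 3.3, p. 87;
[SerreGaloisCohomology1997] I §2.6 (b).  (Standard algebra; no statement is cited as a fact.)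
-/

namespace Summit.BirchSwinnertonDyer.Rank1Residual.GaloisImage.InertiaDivisible

/-! ## §1. Decreasing non-empty subsets of a finite set -/

/-- A decreasing sequence `Y 0 ⊇ Y 1 ⊇ ⋯` of non-empty subsets of a finite set `Y 0` has a common
element (otherwise every `y ∈ Y 0` has left by some stage `k_y`, and `Y (max k_y)` is empty).
[folklore] -/
theorem exists_forall_mem_of_forall_succ_subset {α : Type*} {Y : ℕ → Set α}
    (hanti : ∀ k, Y (k + 1) ⊆ Y k) (hfin : (Y 0).Finite) (hne : ∀ k, (Y k).Nonempty) :
    ∃ y, ∀ k, y ∈ Y k := by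
  have hmono : ∀ {k l : ℕ}, k ≤ l → Y l ⊆ Y k := by
    intro k l hkl
    induction hkl with
    | refl => exact subset_rfl
    | step _ ih => exact (hanti _).trans ih
  by_contra h
  push Not at h
  choose k hk using h
  obtain ⟨y, hy⟩ := hne (hfin.toFinset.sup k)
  have hy0 : y ∈ Y 0 := hmono (Nat.zero_le _) hy
  exact hk y (hmono (Finset.le_sup (f := k) (hfin.mem_toFinset.mpr hy0)) hy)

/-! ## §2. Fibres of multiplication by `n` -/

/-- If `G[n] = {t | n • t = 0}` is finite then every fibre `{y | n • y = x}` is finite (empty, or a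
translate of `G[n]`). [folklore] -/
theorem finite_setOf_nsmul_eq {G : Type*} [AddCommGroup G] {n : ℕ}
    (hfin : {t : G | n • t = 0}.Finite) (x : G) : {y : G | n • y = x}.Finite := by
  by_cases hne : ∃ y₀ : G, n • y₀ = x
  · obtain ⟨y₀, hy₀⟩ := hne
    refine (hfin.image fun t ↦ y₀ + t).subset fun y hy ↦ ⟨y - y₀, ?_, add_sub_cancel y₀ y⟩
    have hy' : n • y = x := hy
    change n • (y - y₀) = 0
    rw [nsmul_sub, hy', hy₀, sub_self]
  · push Not at hne
    refine Set.Finite.subset Set.finite_empty fun y hy ↦ ?_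
    exact (hne y hy).elim

/-! ## §3. The `p`-divisible core -/

/-- **The elements of `N` with `p^k`-th roots in `N` for every `k` form a `p`-divisible set** when
`G[p]` is finite: if `x` has, for every `k`, some `y_k ∈ N` with `p^k • y_k = x`, then `x = p • y`
for some `y ∈ N` which ITSELF has `p^k`-th roots in `N` for every `k`.  Proof: the sets
`Y_k = {y ∈ N | p • y = x ∧ ∃ z ∈ N, p^k • z = y}` are non-empty (`y = p^k • y_{k+1}`), decreasing,
and contained in the finite fibre `{y | p • y = x}`; a common element is the required `y`.
(For `N ≅ (ℚ_p/ℤ_p)^a ⊕ F`, `F` finite, this set is the maximal divisible subgroup.) [folklore] -/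
theorem exists_nsmul_eq_of_forall_exists_pow_nsmul_eq {G : Type*} [AddCommGroup G]
    (N : AddSubgroup G) {p : ℕ} (hfin : {t : G | p • t = 0}.Finite) {x : G}
    (hx : ∀ k : ℕ, ∃ y ∈ N, p ^ k • y = x) :
    ∃ y ∈ N, p • y = x ∧ ∀ k : ℕ, ∃ z ∈ N, p ^ k • z = y := by
  set Y : ℕ → Set G := fun k ↦ {y | y ∈ N ∧ p • y = x ∧ ∃ z ∈ N, p ^ k • z = y} with hY
  have hanti : ∀ k, Y (k + 1) ⊆ Y k := by
    rintro k y ⟨hyN, hyx, z, hzN, hz⟩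
    refine ⟨hyN, hyx, p • z, N.nsmul_mem hzN p, ?_⟩
    rw [smul_smul, ← pow_succ, hz]
  have hne : ∀ k, (Y k).Nonempty := by
    intro k
    obtain ⟨z, hzN, hz⟩ := hx (k + 1)
    refine ⟨p ^ k • z, N.nsmul_mem hzN _, ?_, z, hzN, rfl⟩
    rw [smul_smul, ← pow_succ', hz]
  have hfin0 : (Y 0).Finite := (finite_setOf_nsmul_eq hfin x).subset fun y hy ↦ hy.2.1
  obtain ⟨y, hy⟩ := exists_forall_mem_of_forall_succ_subset hanti hfin0 hne
  exact ⟨y, (hy 0).1, (hy 0).2.1, fun k ↦ (hy k).2.2⟩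

/-! ## §4. Surjectivity of an endomorphism from surjectivity on a core containing the kernel -/

/-- **Surjectivity from a core.**  Let `G` be an additive group in which every element is killed
by a power of `p` and every layer `G[p^k]` is finite, `f` an endomorphism of `G`, and `C ≤ G` a
subgroup with `f(C) ⊆ C`, `f` mapping `C` ONTO `C`, and `ker f ⊆ C`.  Then `f` is surjective.
Proof: `f x ∈ C ⇒ x ∈ C` (`f x = f c`, `x − c ∈ ker f ⊆ C`), so the endomorphism `f̄` of `G ⧸ C`
induced by `f` is injective; it maps the finite image of each layer `G[p^k]` into itself, hence
onto itself; so every `m ∈ G[p^k]` is `f x + c` with `c ∈ C = f(C)`. [folklore] -/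
theorem surjective_of_forall_exists_of_ker_subset {G : Type*} [AddCommGroup G] {p : ℕ}
    (htors : ∀ x : G, ∃ k : ℕ, p ^ k • x = 0) (hfin : ∀ k : ℕ, {x : G | p ^ k • x = 0}.Finite)
    (f : G →+ G) (C : AddSubgroup G) (hC : ∀ x ∈ C, f x ∈ C)
    (hsurjC : ∀ x ∈ C, ∃ y ∈ C, f y = x) (hker : ∀ x, f x = 0 → x ∈ C) :
    Function.Surjective f := by
  -- `f x ∈ C ⇒ x ∈ C`
  have hback : ∀ x, f x ∈ C → x ∈ C := by
    intro x hx
    obtain ⟨y, hyC, hy⟩ := hsurjC _ hx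
    have hxy : x - y ∈ C := hker _ (by rw [map_sub, hy, sub_self])
    have e : x = x - y + y := (sub_add_cancel x y).symm
    rw [e]
    exact C.add_mem hxy hyC
  -- the induced endomorphism of `G ⧸ C`
  have hle : C ≤ C.comap f := fun x hx ↦ hC x hx
  set fbar : G ⧸ C →+ G ⧸ C := QuotientAddGroup.map C C f hle with hfbar
  have hfbar_mk : ∀ x : G, fbar (x : G ⧸ C) = ((f x : G) : G ⧸ C) := fun x ↦
    QuotientAddGroup.map_mk C C f hle x
  have hinj : Function.Injective fbar := by
    rw [injective_iff_map_eq_zero]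
    intro q hq
    obtain ⟨x, rfl⟩ := QuotientAddGroup.mk_surjective q
    rw [hfbar_mk, QuotientAddGroup.eq_zero_iff] at hq
    exact (QuotientAddGroup.eq_zero_iff x).mpr (hback x hq)
  intro m
  obtain ⟨k, hk⟩ := htors m
  -- the finite `f̄`-stable image `S` of the layer `G[p^k]`
  set Q : Set G := {x | p ^ k • x = 0} with hQ
  set S : Set (G ⧸ C) := (fun x : G ↦ (x : G ⧸ C)) '' Q with hS
  have hSfin : S.Finite := (hfin k).image _
  have hmaps : Set.MapsTo fbar S S := by
    rintro _ ⟨x, hx, rfl⟩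
    refine ⟨f x, ?_, (hfbar_mk x).symm⟩
    have hx' : p ^ k • x = 0 := hx
    change p ^ k • f x = 0
    rw [← map_nsmul, hx', map_zero]
  have hbij : Set.BijOn fbar S S :=
    (hSfin.injOn_iff_bijOn_of_mapsTo hmaps).mp (hinj.injOn)
  obtain ⟨_, ⟨x, -, rfl⟩, hx⟩ := hbij.surjOn ⟨m, hk, rfl⟩
  rw [hfbar_mk] at hx
  -- `f x − m ∈ C = f(C)`
  have hdiff : f x - m ∈ C := by
    rw [← QuotientAddGroup.eq_zero_iff, QuotientAddGroup.mk_sub, hx, sub_self]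
  obtain ⟨c, -, hc⟩ := hsurjC _ hdiff
  exact ⟨x - c, by rw [map_sub, hc, sub_sub_cancel]⟩

end Summit.BirchSwinnertonDyer.Rank1Residual.GaloisImage.InertiaDivisible
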